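import Summits.Ventures.HodgeRepro2.T5SU11ResolventSourceIntegrable
import Summits.Ventures.HodgeRepro2.T5SU11ResolventBoundaryEdge

/-!
# The composition `G_λ G_{λ₂}` in closed form: `G_λ f − G_{λ₂} f = (μ − μ₂) G^I_λ(G_{λ₂} f)`

Rows 492–494 built the improper Green's operator `G^I_λ` and showed that the source `g = G_{λ₂} f` is admissible
(`λ, λ₂ > 1`, `f` continuous and supported in `[a, b] ⊂ (0, ∞)`). Here the remaining analytic input for row 488's
uniqueness theorem is supplied — **`G^I_λ g` decays relative to `φ_λ`** at infinity:

  `G^I_λ g / φ_λ = −T_λ B^I − A^I`, with `A^I(t) = ∫_{(t,∞)} χ_λ g sinh → 0` (`tendsto_greenAI_atTop`) and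
  `T_λ(t) B^I(t) → 0` (`tendsto_tailIntegral_mul_greenBI_atTop`: `T_λ ≤ 2K e^{−2(λ−1)t}`, row 468, against
  `|B^I(t)| ≤ C₀ + C t e^{max(λ−λ₂,0) t}` from `|φ_λ g sinh| ≤ C e^{(λ−λ₂)s}` on `[T, ∞)`) —

so that, by the uniqueness of bounded `φ_λ`-decaying solutions of `(L − μ)v = (μ − μ₂) G_{λ₂} f` (row 488),

  **`G_λ f − G_{λ₂} f = (μ − μ₂) · G^I_λ(G_{λ₂} f)` on `(0, ∞)`** (`sphGreen_sub_sphGreen_eq`):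

the resolvent identity `G_λ − G_{λ₂} = (μ − μ₂) G_λ G_{λ₂}` of the radial Laplacian, with the composition
`G_λ G_{λ₂} f` given by the explicit variation-of-parameters formula of row 492 (`greenSolI_eq_div`). Nothing is
claimed about (N).

Blind lane: Mathlib + the HodgeRepro2 prefix only; no sorry; axioms ⊆ {propext, Classical.choice,
Quot.sound}.
-/

namespace Summit.Ventures.HodgeRepro2.T5SU11ResolventComposition

open Filter Topology MeasureTheory intervalIntegral
open Set (Ioi Ioc Icc)
open T5SU11Cartan T5SU11SphericalFunction T5SU11SphericalBounds T5SU11SphericalContinuous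
  T5SU11SphericalSolutionSpaceAll T5SU11ReductionOfOrder T5SU11ReductionOfOrderInfinity T5SU11SphericalDecay
  T5SU11SphericalDecayAsymptotic T5SU11SphericalDecayBracket T5SU11SphericalGreen T5SU11ResolventTransform
  T5SU11ResolventBoundary T5SU11ResolventBoundaryEdge T5SU11RadialGreenImproper
  T5SU11RadialGreenImproperOrigin T5SU11ResolventSourceIntegrable T5SU11ResolventIdentity

section measure

variable [MeasurableSpace Circle] [BorelSpace Circle]

variable {lam lam₂ a b : ℝ} {f : ℝ → ℝ} (hlam : 1 < lam) (hlam₂ : 1 < lam₂) (hf : ContinuousOn f (Ioi 0))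
  (ha : 0 < a) (hab : a ≤ b) (hfa : ∀ s, s ≤ a → f s = 0) (hfb : ∀ s, b ≤ s → f s = 0)

include hlam hlam₂ hf ha hab hfa hfb in
/-- **`A^I(t) → 0`** at infinity: the tail of the convergent integral `∫_{(0,∞)} χ_λ g sinh`. -/
theorem tendsto_greenAI_atTop :
    Tendsto (greenAI (sphDecay lam) (sphGreen lam₂ f a b)) atTop (𝓝 0) := by
  have hA := integrableOn_sphDecay_mul_sphGreen_mul_sinh hlam hlam₂ hf ha hab hfa hfb
  have h := (tendsto_const_nhds (x := ∫ s in Ioi 0, sphDecay lam s * sphGreen lam₂ f a b s * Real.sinh (2 * s))).sub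
    (intervalIntegral_tendsto_integral_Ioi 0 hA (tendsto_id (x := atTop)))
  rw [sub_self] at h
  refine h.congr' ?_
  filter_upwards [eventually_gt_atTop 0] with t ht
  simp only [id]
  rw [greenAI_eq hA ht, integral_of_le ht.le]

include hlam hlam₂ hf ha hab hfa hfb in
/-- **`T_λ(t) B^I(t) → 0`** at infinity. -/
theorem tendsto_tailIntegral_mul_greenBI_atTop :
    Tendsto (fun t => tailIntegral (fun t => sph lam (hyp t)) t * greenBI (fun t => sph lam (hyp t))
      (sphGreen lam₂ f a b) t) atTop (𝓝 0) := by
  have hb : 0 < b := lt_of_lt_of_le ha hab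
  set c₂ := ∫ s in a..b, sph lam₂ (hyp s) * f s * Real.sinh (2 * s) with hc₂
  set c := T5SU11SphericalAsymptotic.cfun (2 - lam) with hc
  set L₂ := 1 / ((lam₂ - 1) * T5SU11SphericalAsymptotic.cfun (2 - lam₂)) with hL₂
  set K := 1 / ((lam - 1) * T5SU11SphericalAsymptotic.cfun (2 - lam) ^ 2) with hK
  have hcpos : 0 < c := T5SU11SphericalCfun.cfun_pos (by linarith)
  have hL₂pos : 0 < L₂ := sphDecay_limit_pos hlam₂
  have hKpos : 0 < K := by
    rw [hK]
    exact div_pos one_pos (mul_pos (by linarith) (pow_pos hcpos 2))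
  obtain ⟨T₀, hT₀⟩ := eventually_atTop.mp (eventually_sph_hyp_le hlam)
  obtain ⟨T₁, hT₁⟩ := eventually_atTop.mp (eventually_sphDecay_le hlam₂)
  obtain ⟨T₂, hT₂⟩ := eventually_atTop.mp (eventually_tailIntegral_le hlam)
  set T := max (max T₀ T₁) (max T₂ (max b 1)) with hT
  have hbT : b ≤ T := le_trans (le_max_left _ _) (le_trans (le_max_right _ _) (le_max_right _ _))
  have h1T : 1 ≤ T := le_trans (le_max_right _ _) (le_trans (le_max_right _ _) (le_max_right _ _))
  have hT0 : 0 < T := lt_of_lt_of_le one_pos h1T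
  set M := max (lam - lam₂) 0 with hM
  have hM0 : 0 ≤ M := le_max_right _ _
  -- the integrand on `[T, ∞)`
  set C := 2 * c * |c₂| * (2 * L₂) / 2 with hC
  have hC0 : 0 ≤ C := by positivity
  have hpt : ∀ s, T ≤ s → |sph lam (hyp s) * sphGreen lam₂ f a b s * Real.sinh (2 * s)|
      ≤ C * Real.exp ((lam - lam₂) * s) := by
    intro s hs
    have hsb : b ≤ s := le_trans hbT hs
    have hs0 : 0 < s := lt_of_lt_of_le hT0 hs
    have hb0 := hT₀ s (le_trans (le_trans (le_max_left _ _) (le_max_left _ _)) hs)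
    have hb1 := hT₁ s (le_trans (le_trans (le_max_right _ _) (le_max_left _ _)) hs)
    rw [sphGreen_eq_of_ge hf ha hab hfb hsb]
    have hsh : Real.sinh (2 * s) ≤ Real.exp (2 * s) / 2 := sinh_le_exp_div_two _
    have hsh0 : 0 ≤ Real.sinh (2 * s) := Real.sinh_nonneg_iff.mpr (by linarith)
    have hχ₂0 : 0 ≤ sphDecay lam₂ s := (sphDecay_pos hlam₂ hs0).le
    rw [abs_mul, abs_mul, abs_of_pos (sph_hyp_pos lam s), abs_of_nonneg hsh0, abs_mul, abs_neg,
      abs_of_nonneg hχ₂0]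
    calc sph lam (hyp s) * (|c₂| * sphDecay lam₂ s) * Real.sinh (2 * s)
        ≤ (2 * c * Real.exp ((lam - 2) * s)) * (|c₂| * (2 * L₂ * Real.exp (-lam₂ * s))) * (Real.exp (2 * s) / 2) :=
          mul_le_mul (mul_le_mul hb0 (mul_le_mul_of_nonneg_left hb1 (abs_nonneg _)) (by positivity)
            (by positivity)) hsh hsh0 (by positivity)
      _ = C * Real.exp ((lam - lam₂) * s) := by
          rw [hC, show Real.exp ((lam - lam₂) * s)
              = Real.exp ((lam - 2) * s) * Real.exp (-lam₂ * s) * Real.exp (2 * s) by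
            rw [← Real.exp_add, ← Real.exp_add]; congr 1; ring]
          ring
  -- `|B^I(t)| ≤ C₀ + C t e^{M t}` for `t ≥ T`
  set C₀ := ∫ s in Ioc 0 T, |sph lam (hyp s) * sphGreen lam₂ f a b s * Real.sinh (2 * s)| with hC₀
  have hBint := integrableOn_sph_mul_sphGreen_mul_sinh_Ioc hlam₂ hf ha hab hfa (lam := lam)
  have hBle : ∀ t, T ≤ t → |greenBI (fun t => sph lam (hyp t)) (sphGreen lam₂ f a b) t|
      ≤ C₀ + C * Real.exp (M * t) * t := by
    intro t ht
    unfold greenBI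
    have hsplit : Ioc 0 T ∪ Ioc T t = Ioc 0 t := Set.Ioc_union_Ioc_eq_Ioc hT0.le ht
    have hdisj : Disjoint (Ioc 0 T) (Ioc T t) := Set.Ioc_disjoint_Ioc_of_le le_rfl
    rw [← hsplit, setIntegral_union hdisj measurableSet_Ioc ((hBint t).mono_set (by rw [← hsplit]; exact Set.subset_union_left))
      ((hBint t).mono_set (by rw [← hsplit]; exact Set.subset_union_right))]
    refine le_trans (abs_add_le _ _) (add_le_add ?_ ?_)
    · have := norm_integral_le_integral_norm (μ := volume.restrict (Ioc 0 T))
        (fun s => sph lam (hyp s) * sphGreen lam₂ f a b s * Real.sinh (2 * s))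
      simpa only [Real.norm_eq_abs] using this
    · have h := norm_setIntegral_le_of_norm_le_const (μ := volume) (s := Ioc T t)
        (f := fun s => sph lam (hyp s) * sphGreen lam₂ f a b s * Real.sinh (2 * s))
        (C := C * Real.exp (M * t)) (by rw [Real.volume_Ioc]; exact ENNReal.ofReal_lt_top) (fun s hs => ?_)
      · rw [Real.norm_eq_abs, Real.volume_real_Ioc_of_le ht] at h
        calc |∫ s in Ioc T t, sph lam (hyp s) * sphGreen lam₂ f a b s * Real.sinh (2 * s)|
            ≤ C * Real.exp (M * t) * (t - T) := h
          _ ≤ C * Real.exp (M * t) * t := by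
              refine mul_le_mul_of_nonneg_left (by linarith) (by positivity)
      · rw [Real.norm_eq_abs]
        refine le_trans (hpt s hs.1.le) (mul_le_mul_of_nonneg_left (Real.exp_le_exp.mpr ?_) hC0)
        have hs0 : 0 ≤ s := le_trans hT0.le hs.1.le
        calc (lam - lam₂) * s ≤ M * s := mul_le_mul_of_nonneg_right (le_max_left _ _) hs0
          _ ≤ M * t := mul_le_mul_of_nonneg_left hs.2 hM0
  -- the limit
  have hlim : Tendsto (fun t => 2 * K * Real.exp (-(2 * (lam - 1)) * t) * C₀
      + 2 * K * C * (t * Real.exp (-(2 * (lam - 1) - M) * t))) atTop (𝓝 0) := by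
    have h1 : Tendsto (fun t => Real.exp (-(2 * (lam - 1)) * t)) atTop (𝓝 0) := by
      have := Real.tendsto_exp_neg_atTop_nhds_zero.comp (tendsto_id.const_mul_atTop (by linarith : 0 < 2 * (lam - 1)))
      refine this.congr' (Eventually.of_forall fun t => ?_)
      simp only [Function.comp_def, id]
      ring_nf
    have h2 : Tendsto (fun t => t * Real.exp (-(2 * (lam - 1) - M) * t)) atTop (𝓝 0) := by
      refine tendsto_mul_exp_neg_mul_atTop ?_
      rw [hM]
      rcases le_or_gt 0 (lam - lam₂) with h | h
      · rw [max_eq_left h]; linarith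
      · rw [max_eq_right h.le]; linarith
    have := ((h1.const_mul (2 * K)).mul_const C₀).add (h2.const_mul (2 * K * C))
    simpa only [mul_zero, zero_mul, add_zero] using this
  refine squeeze_zero_norm' ?_ hlim
  filter_upwards [eventually_ge_atTop T] with t ht
  have hTle := hT₂ t (le_trans (le_trans (le_max_left _ _) (le_max_right _ _)) ht)
  have hTpos : 0 < tailIntegral (fun t => sph lam (hyp t)) t :=
    tailIntegral_pos (hφ_sph lam) (hpos_sph lam) (integrableOn_roIntegrand_sph hlam) (lt_of_lt_of_le hT0 ht)
  rw [Real.norm_eq_abs, abs_mul, abs_of_pos hTpos]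
  calc tailIntegral (fun t => sph lam (hyp t)) t * |greenBI (fun t => sph lam (hyp t)) (sphGreen lam₂ f a b) t|
      ≤ (2 * K * Real.exp (-(2 * (lam - 1)) * t)) * (C₀ + C * Real.exp (M * t) * t) :=
        mul_le_mul hTle (hBle t ht) (abs_nonneg _) (by positivity)
    _ = 2 * K * Real.exp (-(2 * (lam - 1)) * t) * C₀
        + 2 * K * C * (t * Real.exp (-(2 * (lam - 1) - M) * t)) := by
        rw [show Real.exp (-(2 * (lam - 1) - M) * t) = Real.exp (-(2 * (lam - 1)) * t) * Real.exp (M * t) by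
          rw [← Real.exp_add]; congr 1; ring]
        ring

include hlam hlam₂ hf ha hab hfa hfb in
/-- **`G^I_λ(G_{λ₂} f)/φ_λ → 0`** at infinity. -/
theorem tendsto_greenSolI_div_atTop :
    Tendsto (fun t => greenSolI (fun t => sph lam (hyp t)) (sphDecay lam) (sphGreen lam₂ f a b) t / sph lam (hyp t))
      atTop (𝓝 0) := by
  have h := ((tendsto_tailIntegral_mul_greenBI_atTop hlam hlam₂ hf ha hab hfa hfb).neg).sub
    (tendsto_greenAI_atTop hlam hlam₂ hf ha hab hfa hfb)
  rw [neg_zero, sub_zero] at h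
  refine h.congr' (Eventually.of_forall fun t => ?_)
  have hφ : sph lam (hyp t) ≠ 0 := (sph_hyp_pos lam t).ne'
  show -(tailIntegral (fun t => sph lam (hyp t)) t * greenBI (fun t => sph lam (hyp t)) (sphGreen lam₂ f a b) t)
    - greenAI (sphDecay lam) (sphGreen lam₂ f a b) t
    = (-(sphDecay lam t * greenBI (fun t => sph lam (hyp t)) (sphGreen lam₂ f a b) t)
        - sph lam (hyp t) * greenAI (sphDecay lam) (sphGreen lam₂ f a b) t) / sph lam (hyp t)
  have hχ : sphDecay lam t = sph lam (hyp t) * tailIntegral (fun t => sph lam (hyp t)) t := rfl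
  rw [hχ]
  field_simp

include hlam hlam₂ hf ha hab hfa hfb in
/-- **THE COMPOSITION IN CLOSED FORM**: `G_λ f − G_{λ₂} f = (μ − μ₂) · G^I_λ(G_{λ₂} f)` on `(0, ∞)`, i.e.
`G_λ G_{λ₂} f = G^I_λ(G_{λ₂} f)` is the improper variation-of-parameters formula of row 492. -/
theorem sphGreen_sub_sphGreen_eq {t : ℝ} (ht : 0 < t) :
    sphGreen lam f a b t - sphGreen lam₂ f a b t
      = (lam * (lam - 2) - lam₂ * (lam₂ - 2))
        * greenSolI (fun t => sph lam (hyp t)) (sphDecay lam) (sphGreen lam₂ f a b) t := by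
  have hg := continuousOn_sphGreen hlam₂ hf ha hab
  have hB := integrableOn_sph_mul_sphGreen_mul_sinh_Ioc hlam₂ hf ha hab hfa (lam := lam)
  have hA := integrableOn_sphDecay_mul_sphGreen_mul_sinh hlam hlam₂ hf ha hab hfa hfb
  obtain ⟨M, hM0, hM⟩ := exists_abs_sphGreen_le_of_le_one hlam₂ hf ha hab hfa
  set κ := lam * (lam - 2) - lam₂ * (lam₂ - 2) with hκ
  -- the candidate `v = κ G^I g` and its derivative data
  have hv : ∀ s, 0 < s → HasDerivAt (fun s => κ * greenSolI (fun t => sph lam (hyp t)) (sphDecay lam)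
      (sphGreen lam₂ f a b) s)
      (κ * greenSolI' (deriv fun t => sph lam (hyp t)) (sphDecay' lam) (fun t => sph lam (hyp t)) (sphDecay lam)
        (sphGreen lam₂ f a b) s) s :=
    fun s hs => (hasDerivAt_greenSolI (hφ_sph lam) (fun _ hs => hasDerivAt_sphDecay hlam hs) hg hB hA hs).const_mul κ
  have hv' : ∀ s, 0 < s → HasDerivAt (fun s => κ * greenSolI' (deriv fun t => sph lam (hyp t)) (sphDecay' lam)
      (fun t => sph lam (hyp t)) (sphDecay lam) (sphGreen lam₂ f a b) s)
      (κ * greenSolI'' (deriv (deriv fun t => sph lam (hyp t))) (sphDecay'' lam) (deriv fun t => sph lam (hyp t))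
        (sphDecay' lam) (fun t => sph lam (hyp t)) (sphDecay lam) (sphGreen lam₂ f a b) s) s :=
    fun s hs => (hasDerivAt_greenSolI' (hφ_sph lam) (hφ'_sph lam) (fun _ hs => hasDerivAt_sphDecay hlam hs)
      (fun _ hs => hasDerivAt_sphDecay' lam hs) hg hB hA hs).const_mul κ
  have hvode : ∀ s, 0 < s → Real.sinh (2 * s) * (κ * greenSolI'' (deriv (deriv fun t => sph lam (hyp t)))
        (sphDecay'' lam) (deriv fun t => sph lam (hyp t)) (sphDecay' lam) (fun t => sph lam (hyp t)) (sphDecay lam)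
        (sphGreen lam₂ f a b) s)
      + 2 * Real.cosh (2 * s) * (κ * greenSolI' (deriv fun t => sph lam (hyp t)) (sphDecay' lam)
        (fun t => sph lam (hyp t)) (sphDecay lam) (sphGreen lam₂ f a b) s)
      = lam * (lam - 2) * Real.sinh (2 * s) * (κ * greenSolI (fun t => sph lam (hyp t)) (sphDecay lam)
          (sphGreen lam₂ f a b) s)
        + Real.sinh (2 * s) * (κ * sphGreen lam₂ f a b s) := by
    intro s hs
    have e := greenSolI_ode (hode_sph lam) (fun _ hs => sphDecay_ode hlam hs) (fun _ hs => wronskian_sphDecay hlam hs)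
      (g := sphGreen lam₂ f a b) hs
    linear_combination κ * e
  obtain ⟨B, hBd⟩ := eventually_abs_greenSolI_le hlam hM hM0 hA
  have hvB : ∀ᶠ s in 𝓝[>] (0 : ℝ), |κ * greenSolI (fun t => sph lam (hyp t)) (sphDecay lam) (sphGreen lam₂ f a b) s|
      ≤ |κ| * B := by
    filter_upwards [hBd] with s hs
    rw [abs_mul]
    exact mul_le_mul_of_nonneg_left hs (abs_nonneg _)
  have hvd : Tendsto (fun s => κ * greenSolI (fun t => sph lam (hyp t)) (sphDecay lam) (sphGreen lam₂ f a b) s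
      / sph lam (hyp s)) atTop (𝓝 0) := by
    have := (tendsto_greenSolI_div_atTop hlam hlam₂ hf ha hab hfa hfb).const_mul κ
    rw [mul_zero] at this
    refine this.congr' (Eventually.of_forall fun s => ?_)
    ring
  have := eq_resolvent_diff_of_ode hlam hlam₂ hf ha hab hfa hfb hv hv' hvode hvB hvd ht
  exact this.symm

end measure

end Summit.Ventures.HodgeRepro2.T5SU11ResolventComposition
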